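import Literature.Topology.FourManifolds.WallHandlebodyBall
import Literature.Topology.FourManifolds.RegularSlabCobordism
import Literature.Topology.FourManifolds.HCobordismLevelConnectivityProofs
import Literature.Topology.FourManifolds.CobordismEndLevelsDiffeo
import HarnessLib

/-!
# Wall 1964, Lemma 2, Morse-theoretic route: the cobordism `K = f⁻¹[a₀, b₀]` from the bottom
# sphere to (a copy of) `M`

Topic `Literature/Topology/FourManifolds` (fact seat
`provefact-Literature.Topology.FourManifolds.exists-68ee520c9a`, Wall 1964, Lemma 2,
`WallBoundingHandlebody.lean`; items 1–2 of the route recorded there).  Everything here is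
**proved**; no named facts.

Given the bottom ball of `WallHandlebodyBall.lean` — a Morse function `f` on the triad
`(W; ∅, M)` whose sublevel set `{f ≤ a₀}` is a chart ball around the unique bottom critical
point `p₀` — we choose a second non-critical level `b₀ ∈ (a₀, 1)` above all critical values
and so close to `1` that the level `f⁻¹(b₀)` is a smooth copy of `M` (Milnor 1965, Thm. 3.4 /
Cor. 3.5 at the end `M`: the tree's `Cobordism.IsMorseFunction.exists_pos_nonempty_diffeomorph_level`
applied to the turned-about triad `(W; M, ∅)` and `1 - f`).  The data is bundled as
`NullCobordism.BottomSlab` (`nonempty_bottomSlab`).  Then (namespace `NullCobordism.BottomSlab`):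

* `isRegularSlab`: `f⁻¹[a₀, b₀]` is a regular slab of the triad (`RegularSlabCobordism.lean`), so
  `K = RegularSlab …` is a compact `(n+1)`-manifold with boundary and
  `cobordism : Cobordism n (botEnd) (topEnd)` is the triad `(K; f⁻¹(a₀), f⁻¹(b₀))` with its
  Morse function `(f - a₀)/(b₀ - a₀)` (Milnor 1965, Lemma 2.9, Def. 3.1) — Wall's
  `W − D̊⁵` as a cobordism from `S⁴ = ∂D⁵`, cut off below `M` along a collar level;
* `simplyConnectedSpace_botEnd`: the incoming end `f⁻¹(a₀)` is an `n`-sphere, simply connected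
  for `n ≥ 2`; `nonempty_diffeomorph_topEnd`: the outgoing end is diffeomorphic to `M`;
* `simplyConnectedSpace_K`: `K` is simply connected when `W` is and `n ≥ 2` — `{a₀ ≤ f}` is
  simply connected (`BottomBall.isSimplyConnected_setOf_le`) and cutting off the collar
  `f⁻¹(b₀, 1]`, which contains no critical point, does not change the fundamental group
  (Milnor 1965, Thm. 3.14 / p. 56 as the tree's `Cobordism.isSimplyConnected_slab_left`, fed with
  the discharged Thm. 3.14 and Def. 3.9 facts);
* `exists_joined_inl`: every point of `K` is joined by a path to the incoming end
  (`H₀(K, f⁻¹(a₀)) = 0`, the hypothesis of Milnor's Thm. 8.1 Index 0).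

## References

* C. T. C. Wall, *On simply-connected 4-manifolds*, J. London Math. Soc. 39 (1964), proof of
  Lemma 2 (p. 144). [WallJLMS1964]
* J. Milnor, *Lectures on the h-cobordism theorem* (1965), Def. 1.3, Lemma 2.9, Def. 3.1,
  Thm. 3.4, Cor. 3.5, Thm. 3.14 (PDF pp. 2–21), proof of Thm. 8.1 (PDF p. 56).
  [MilnorHCobordism1965]
-/

open scoped Manifold ContDiff Topology
open Set Function Metric Filter

noncomputable section

universe u

namespace Literature.Topology.FourManifolds

/-- Local notation: `𝔼 n` is the model Euclidean space `EuclideanSpace ℝ (Fin n)`. -/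
local notation "𝔼 " n:arg => EuclideanSpace ℝ (Fin n)

namespace NullCobordism

variable {n : ℕ} {M : Type u} [TopologicalSpace M] [ChartedSpace (𝔼 n) M]

/-- **The bottom ball together with a top collar level.**  The bottom ball data
(`NullCobordism.BottomBall`) and a level `b₀` with `a₀ < b₀ < 1`, above every critical value of
`f`, such that every manifold smoothly embedded onto the level `f⁻¹(b₀)` is diffeomorphic to
`M` (Milnor 1965, Thm. 3.4 / Cor. 3.5: the levels near the end `M` of the triad `(W; ∅, M)`
are the slices of a collar of `M`). [cite: MilnorHCobordism1965, Thm. 3.4 and Cor. 3.5 (PDF pp. 12–13)] [cite: WallJLMS1964, proof of Lemma 2 (p. 144)] -/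
structure BottomSlab (c : NullCobordism n M) extends BottomBall c where
  /-- The top level. -/
  b₀ : ℝ
  /-- The top level lies above the bottom level. -/
  botLevel_lt_b₀ : toBottomBall.botLevel < b₀
  /-- The top level lies below `1 = f|M`. -/
  b₀_lt_one : b₀ < 1
  /-- Every critical value lies below the top level. -/
  apply_lt_b₀ : ∀ q ∈ criticalSet (𝓡∂ (n + 1)) f, f q < b₀
  /-- Every manifold smoothly embedded onto the top level is a copy of `M`. -/
  nonempty_diffeomorph : ∀ (V : Type u) [TopologicalSpace V] [ChartedSpace (𝔼 n) V]
    [IsManifold (𝓡 n) ∞ V] (ι : V → c.W),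
    Manifold.IsSmoothEmbedding (𝓡 n) (𝓡∂ (n + 1)) ∞ ι → range ι = f ⁻¹' {b₀} →
      Nonempty (M ≃ₘ⟮𝓡 n, 𝓡 n⟯ V)

section Existence

variable [T2Space M] [SecondCountableTopology M] [IsManifold (𝓡 n) ∞ M] [CompactSpace M]
  [Nonempty M] (c : NullCobordism n M)

/-- **Existence of the bottom slab data**: the bottom ball exists (`nonempty_bottomBall`); the
critical values are finitely many and `< 1`, and the levels of `1 - f` near the incoming end
`M` of the turned-about triad `(W; M, ∅)` are copies of `M`
(`Cobordism.IsMorseFunction.exists_pos_nonempty_diffeomorph_level`), so a top level `b₀` close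
to `1` has all the required properties. [cite: MilnorHCobordism1965, Thm. 3.4 and Cor. 3.5 (PDF pp. 12–13), Lemma 2.8] -/
theorem nonempty_bottomSlab : Nonempty c.BottomSlab := by
  classical
  obtain ⟨B⟩ := c.nonempty_bottomBall
  have hf := B.isMorseFunction
  -- the collar levels near `M`
  obtain ⟨ε₀, hε₀, H⟩ := hf.symm.exists_pos_nonempty_diffeomorph_level
  -- the largest critical value
  have hfin : (criticalSet (𝓡∂ (n + 1)) B.f).Finite := hf.finite_criticalSet
  have hne : (criticalSet (𝓡∂ (n + 1)) B.f).Nonempty := ⟨B.p₀, B.isMCriticalPt⟩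
  obtain ⟨qm, hqm, hqmax⟩ := Set.exists_max_image _ B.f hfin hne
  have hqm1 : B.f qm < 1 := (hf.apply_mem_Ioo_of_mem_criticalSet hqm).2
  have ha1 : B.botLevel < 1 := B.botLevel_lt_one
  set ε' : ℝ := min ε₀ ((1 - max B.botLevel (B.f qm)) / 2) with hε'
  have hmax1 : max B.botLevel (B.f qm) < 1 := max_lt ha1 hqm1
  have hε'pos : 0 < ε' := lt_min hε₀ (by linarith)
  have hε'le : ε' ≤ ε₀ := min_le_left _ _
  have hε'lt : ε' < 1 - max B.botLevel (B.f qm) := (min_le_right _ _).trans_lt (by linarith)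
  refine ⟨{ toBottomBall := B
            b₀ := 1 - ε'
            botLevel_lt_b₀ := by have := le_max_left B.botLevel (B.f qm); linarith
            b₀_lt_one := by linarith
            apply_lt_b₀ := fun q hq => by
              have h1 := hqmax q hq
              have h2 := le_max_right B.botLevel (B.f qm)
              linarith
            nonempty_diffeomorph := fun V _ _ _ ι hι hrange => ?_ }⟩
  refine H ε' hε'pos hε'le V ι hι ?_
  have key : (B.f ⁻¹' {1 - ε'} : Set c.W) = (fun z : c.W => 1 - B.f z) ⁻¹' {ε'} := by
    ext z
    simp only [mem_preimage, mem_singleton_iff]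
    constructor <;> intro h <;> linarith
  exact hrange.trans key

end Existence

namespace BottomSlab

variable {c : NullCobordism n M} (S : c.BottomSlab)

/-- **`f⁻¹[a₀, b₀]` is a regular slab of the triad `(W; ∅, M)`** (both levels are positive,
`< 1`, ordered and non-critical). [cite: MilnorHCobordism1965, Lemma 2.9] -/
theorem isRegularSlab : c.cob.IsRegularSlab S.f S.botLevel S.b₀ where
  isMorseFunction := S.isMorseFunction
  pos := S.botLevel_pos
  lt := S.botLevel_lt_b₀
  lt_one := S.b₀_lt_one
  ne_left := fun _ hz => S.ne_botLevel hz
  ne_right := fun z hz => (S.apply_lt_b₀ z hz).ne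

/-- **Wall's `K = W − D̊`, cut off below `M`: the compact manifold with boundary
`K = f⁻¹[a₀, b₀]`.** [cite: WallJLMS1964, proof of Lemma 2 (p. 144)] -/
abbrev K : Type u := RegularSlab S.isRegularSlab

/-- **The triad `(K; f⁻¹(a₀), f⁻¹(b₀))` as a cobordism** from the bottom sphere to the copy
`f⁻¹(b₀)` of `M` (Milnor 1965, Lemma 2.9 with Def. 1.1). [cite: MilnorHCobordism1965, Lemma 2.9 with Def. 1.1] -/
abbrev cobordism : Cobordism n (RegularSlab.botEnd S.isRegularSlab) (RegularSlab.topEnd S.isRegularSlab) :=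
  RegularSlab.cobordism S.isRegularSlab

/-- **The Morse function `(f - a₀)/(b₀ - a₀)` on the cobordism `K`** (Milnor 1965, Def. 3.1
on the sub-triad; dimension `n + 1 ≥ 2`). [cite: MilnorHCobordism1965, Def. 3.1 with Lemma 2.9] -/
theorem isMorseFunction_fn (hn : 1 ≤ n) : S.cobordism.IsMorseFunction (RegularSlab.fn S.isRegularSlab) :=
  RegularSlab.isMorseFunction_fn S.isRegularSlab hn

/-- **The incoming end of `K` is simply connected** (`n ≥ 2`): it is embedded onto the bottom
level `f⁻¹(a₀)`, an `n`-sphere. [cite: HatcherAT2002, Prop. 1.14] [cite: WallJLMS1964, proof of Lemma 2 (p. 144)] -/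
theorem simplyConnectedSpace_botEnd (hn : 2 ≤ n) :
    SimplyConnectedSpace (RegularSlab.botEnd S.isRegularSlab) :=
  S.simplyConnectedSpace_of_range_eq hn _ (fun p => RegularSlab.incl S.isRegularSlab p.1)
    (RegularSlab.isEmbedding_incl_botEnd S.isRegularSlab) (RegularSlab.range_incl_botEnd S.isRegularSlab)

/-- **The outgoing end of `K` is a copy of `M`** (it is smoothly embedded onto the collar level
`f⁻¹(b₀)`). [cite: MilnorHCobordism1965, Thm. 3.4 and Cor. 3.5 (PDF pp. 12–13)] -/
theorem nonempty_diffeomorph_topEnd [NeZero n] [IsManifold (𝓡 n) ∞ M] :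
    Nonempty (M ≃ₘ⟮𝓡 n, 𝓡 n⟯ RegularSlab.topEnd S.isRegularSlab) :=
  S.nonempty_diffeomorph _ (fun p => RegularSlab.incl S.isRegularSlab p.1)
    (RegularSlab.isSmoothEmbedding_incl_topEnd S.isRegularSlab)
    (RegularSlab.range_incl_topEnd S.isRegularSlab)

/-- The incoming end of `K` is nonempty (the bottom sphere has the point with coordinates
`ε e₀`). [folklore] -/
theorem nonempty_botEnd : Nonempty (RegularSlab.botEnd S.isRegularSlab) := by
  set i₀ : Fin (n + 1) := ⟨0, Nat.succ_pos n⟩ with hi₀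
  set v : 𝔼 (n + 1) := EuclideanSpace.single i₀ S.ε with hv
  have hvn : ‖v‖ = S.ε := by
    rw [hv, PiLp.norm_single, Real.norm_eq_abs, abs_of_pos S.ε_pos]
  obtain ⟨hs, hc⟩ := S.symm_add_mem_source (v := v) (by rw [hvn]; exact S.ε_lt.le)
  set z := (S.chart.extend (𝓡∂ (n + 1))).symm (S.chart.extend (𝓡∂ (n + 1)) S.p₀ + v) with hz
  have hzl : S.f z = S.botLevel := (S.apply_eq_botLevel_iff z).2 ⟨hs, by rw [hc, hvn]⟩
  have hzl' : z ∈ S.f ⁻¹' {S.toBottomBall.botLevel} := hzl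
  obtain ⟨p, -⟩ := (Set.ext_iff.1 (RegularSlab.range_incl_botEnd S.isRegularSlab) z).2 hzl'
  exact ⟨p⟩

section SimplyConnected

variable [T2Space M] [SecondCountableTopology M] [IsManifold (𝓡 n) ∞ M] [CompactSpace M]

/-- **`K` is simply connected when `W` is** (`n ≥ 2`).  `{a₀ ≤ f} = f⁻¹[a₀, 1]` is simply
connected (`BottomBall.isSimplyConnected_setOf_le`), and `f⁻¹[a₀, b₀]` is obtained from it by
cutting off the collar `f⁻¹(b₀, 1]`, which contains no critical point: the tree's
`Cobordism.isSimplyConnected_slab_left` (Milnor 1965, PDF p. 56 via Thm. 3.14, fed with the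
discharged facts `Cobordism.Milnor1965_deformationRetract_leftHandDiscs_holds` and
`Cobordism.Milnor1965_leftHandDisc_isDisc_holds`), in the vacuous case of no critical points of
index `< 3` in between. [cite: MilnorHCobordism1965, proof of Thm. 8.1 (PDF p. 56) with Thm. 3.14 (PDF pp. 19–21)] [cite: WallJLMS1964, proof of Lemma 2 (p. 144: "C is also simply-connected")] -/
theorem simplyConnectedSpace_K [SimplyConnectedSpace c.W] (hn : 2 ≤ n) : SimplyConnectedSpace S.K := by
  have hf := S.isMorseFunction
  obtain ⟨ξ, hξ⟩ := Cobordism.Milnor1965_exists_isGradientLike_holds (c := c.cob) hf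
  have h1 : IsSimplyConnected (S.f ⁻¹' Icc S.botLevel 1) := by
    have heq : S.f ⁻¹' Icc S.botLevel 1 = {q | S.botLevel ≤ S.f q} := by
      ext q
      simp only [mem_preimage, mem_Icc, mem_setOf_eq]
      exact ⟨fun h => h.1, fun h => ⟨h, (hf.mem_Icc q).2⟩⟩
    rw [heq]
    exact S.isSimplyConnected_setOf_le hn
  have hreg : ∀ z ∈ criticalSet (𝓡∂ (n + 1)) S.f, S.f z ≠ S.b₀ ∧ S.f z ≠ 1 := fun z hz =>
    ⟨(S.apply_lt_b₀ z hz).ne, (hf.apply_mem_Ioo_of_mem_criticalSet hz).2.ne⟩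
  have key := (Cobordism.isSimplyConnected_slab_left
    Cobordism.Milnor1965_deformationRetract_leftHandDiscs_holds
    Cobordism.Milnor1965_leftHandDisc_isDisc_holds hf ξ hξ S.botLevel_pos.le S.botLevel_lt_b₀.le
    S.b₀_lt_one le_rfl hreg).2 (fun z hz hzI => absurd (S.apply_lt_b₀ z hz) (not_lt.2 hzI.1.le)) h1
  exact key.simplyConnectedSpace

/-- **`H₀(K, f⁻¹(a₀)) = 0`**: every point of `K` is joined by a path in `K` to a point of the
incoming end (the hypothesis of Milnor's Thm. 8.1 Index 0: `K` is path connected and the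
incoming end is nonempty). [cite: MilnorHCobordism1965, Thm. 8.1 (PDF p. 54)] -/
theorem exists_joined_inl [SimplyConnectedSpace c.W] (hn : 2 ≤ n) (z : S.cobordism.W) :
    ∃ x, Joined z (S.cobordism.inl x) := by
  haveI : SimplyConnectedSpace S.cobordism.W := S.simplyConnectedSpace_K hn
  obtain ⟨x⟩ := S.nonempty_botEnd
  exact ⟨x, PathConnectedSpace.joined z _⟩

end SimplyConnected

end BottomSlab

end NullCobordism

end Literature.Topology.FourManifolds
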